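import Literature.MathematicalPhysics.QuantumFieldTheory.Balaban1983to89.B9Eq3124HZKnitPairReg335Y

/-!
# `Balaban1983to89.B9Eq3124HZKnitPairReg335YMemG` — T. Bałaban, *Propagators for lattice gauge theories in a background field*, Commun. Math. Phys. **99** (1985) 389–434
# [Balaban1985BackgroundPropagators] (3.19) p. 393 («parallel transport operators defined by (52), (53) in [5]»), (3.35) p. 396 («U has values in G»); T. Bałaban, *Averaging
# operations for lattice gauge theories*, Commun. Math. Phys. **98** (1985) 17–51 [Balaban1985Averaging] Prop. 2 (52)–(54) p. 26: ★★ **ON THE MEMBER's LOCAL CLASS (3.35) THE KNIT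
# TRANSPORTERS `U(Γ^{(j)}_{y,w})` AND THE KNIT SITE TABLE `parKnitY U` ARE `G`-VALUED FOR EVERY AVERAGING-CLOSED `G`** — the `G`-valued edition of `B9Eq3124HZKnitPairReg335Y`'s
# unitary pair `knitT_mem_unitary_of_reg335P ∕ parKnitY_mem_unitary_of_reg335P` (node00-def-Y g33's by-name spec for the knit certificate's guarded transporter law `hparG`)

statement-level skeleton of published theorems with citation tags; proofs where landed; nothing here is a claim about the Yang–Mills mass gap

WHY THIS FILE.  The CASCADE-K junction (dag-n06-c's `sectBStepUParG_of_members`, def-Y ruling (α)) displays `hparG : … → Reg335 c35 α₀ U → ∀ z w, parA j U z w ∈ G` for the frame's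
general group `G`; the tree had the membership only in the ambient `U(N)` (`parKnitY_mem_unitary_of_reg335P`, keyed on the local class) or in `G` but keyed on B8's GLOBAL regularity
(`B9B8KnitLetterRegular.parKnitY_mem_of_pdev`).  THIS FILE: `knitT_mem_of_reg335P`, `parKnitY_mem_of_reg335P` — the parent's proofs VERBATIM with `U(N)` replaced by `G` (membership in `G`
needs closure of `G` under B8's averaging, `AvgClosed (d+1) L G`, not unitarity; the plaquette smallness `pdev_retract_block_lt` needs only `‖u‖ ≤ 1` on `G`); the parent's
unitary pair is the case `G := U(N)` read through `hGU` (cite it; not restated).  HONEST SCOPE.  Group bookkeeping for B8's iterated averages on (3.35); no estimate of [B9] asserted; count-neutral; nothing continuum ∕ OS ∕ mass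
gap ∕ Clay.  Cell `pub-ymgap` (D-0062), Track A node N06 [B9], seat `pub-ymgap-dag-n06-l` (g37), 2026-08-30; NEW file; nothing landed is modified.
-/

noncomputable section

namespace Literature.MathematicalPhysics.QuantumFieldTheory.Balaban1983to89.B9Eq3124HZKnitPairReg335YMemG

open B7Prop1Explicit renaming Site → LSite
open B7Prop1Local (AgreeOn)
open Literature.MathematicalPhysics.QuantumLattice (blockBase blockMap)
open B7Prop2Explicit (avgIter_mem AvgClosed pdev hol_mem_of C0 c2' unitaryUnits avgClosed_unitaryUnits)
open B7Eq52RetractionExtension (retrCfg retrCfg_eq_of_bondIn retrCfg_mem)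
open B8Eq119TwistedAxial (bgT)
open B4Reflection242 (blk)
open B6Geom246MultiLevelBox (blkOf)
open B6KLevelCensusIndexV1 (KIdx kGeo)
open B9B8CarrierDictionary (liftCfg liftCfg_mem)
open B9B8AveragingKernelZd (compT)
open B9B8AveragingJunction (knitT parOfT parKnitY blockMap_iterate blk_eq_blockMap)
open B9B8KnitLetterRegular (compT_mem)
open B9C2FormBoxRegimeY (Kpl)
open B9BackgroundsKLevelV1P (bg9KP mem_of_reg335P)
open B9Eq3124HZKnitPairReg335Y (pdev_retract_block_lt compT_bgT_congr)
open Node00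

variable {d ℓ : ℕ} {hd : 1 ≤ d + 1} {hL : Odd (ℓ + 1) ∧ 1 < ℓ + 1} {b₀ b₁ : ℝ}

section Legs

open scoped Matrix Matrix.Norms.L2Operator

variable {N : ℕ} [Nonempty (Fin N)] (i : KIdx d ℓ hd hL b₀ b₁) {G : Subgroup (Matrix (Fin N) (Fin N) ℂ)ˣ}

/-- ★★ **ON (3.35) THE KNIT TRANSPORTER TO EVERY SITE IS `G`-VALUED** for an averaging-closed `G` of contractions: `U(Γ^{(j)}_{y,w}) ∈ G` for every box site `w` (block `s = (j, y)`),
for a `G`-valued background in the member's local class with `K_pl(Mα₀)·L⁴ < α₀′` and [5] Prop. 2's smallness of `α₀′`: the leg reads `U♯` on the block only (`compT_bgT_congr`), where it may be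
replaced by the retraction, whose averages `Ūⁱ`, `i ≤ j`, are `G`-valued (`avgIter_mem`).  (The parent's `knitT_mem_unitary_of_reg335P` with `U(N) ↦ G`.)
[cite: Balaban1985BackgroundPropagators, (3.19) p.393, (3.35) p.396; Balaban1985Averaging, Prop. 2 (52)–(54) p.26, p.24] -/
theorem knitT_mem_of_reg335P (hG : AvgClosed (d + 1) (ℓ + 1) G) (hG1 : ∀ u : (Matrix (Fin N) (Fin N) ℂ)ˣ, u ∈ G → ‖(u : Matrix (Fin N) (Fin N) ℂ)‖ ≤ 1)
    (U : CfgY (Matrix (Fin N) (Fin N) ℂ) i) {c₀ α₀ : ℝ} (hc : c₀ ≤ 10) (hMα : 0 ≤ (kGeo i).M * α₀)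
    (hreg : (bg9KP (Matrix (Fin N) (Fin N) ℂ) G i).Reg335 c₀ α₀ U) {α₀' : ℝ} (hα' : 0 < α₀') (hα3 : C0 (d + 1) * α₀' ≤ 1 / 3)
    (hα2 : 2 * α₀' ≤ c2' (d + 1) (ℓ + 1)) (hK : Kpl i ((kGeo i).M * α₀) * (kGeo i).L ^ 4 < α₀') (w : SiteY i) :
    knitT i (bgT (ℓ + 1) (liftCfg U)) w ∈ G := by
  letI : CStarAlgebra (Matrix (Fin N) (Fin N) ℂ) := {}
  have hL1 : 1 ≤ ℓ + 1 := Nat.succ_pos ℓ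
  have hL2 : 2 ≤ ℓ + 1 := hL.2
  set s : BlkY i := blkOf i.D.toDomains w with hs
  set j : ℕ := s.1.1 with hj
  have hjw : levY i w = j := rfl
  have hyw : blk ((ℓ + 1) ^ j) w.1 = s.1.2 := rfl
  have hit : (blockMap (ℓ + 1))^[j] w.1 = s.1.2 := by rw [blockMap_iterate, ← blk_eq_blockMap]; exact hyw
  -- the retraction of `U♯` to the block box of `s`
  set lo : LSite (d + 1) := blockBase ((ℓ + 1) ^ j) s.1.2 with hlo
  set hi : LSite (d + 1) := blockBase ((ℓ + 1) ^ j) s.1.2 + ((((ℓ + 1 : ℕ) : ℤ) ^ j) - 1) • (1 : LSite (d + 1)) with hhi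
  set V : LSite (d + 1) → Fin (d + 1) → (Matrix (Fin N) (Fin N) ℂ)ˣ := retrCfg lo hi (liftCfg U) with hV
  have hagree : AgreeOn lo hi (liftCfg U) V := fun x μ hx hxe => (retrCfg_eq_of_bondIn (liftCfg U) ⟨hx, hxe⟩).symm
  have hU : ∀ μ x, U μ x ∈ G := fun μ x => mem_of_reg335P (G := G) i hreg μ x
  have hVu : ∀ x μ, V x μ ∈ G := fun x μ => retrCfg_mem (fun x μ => liftCfg_mem hU x μ) x μ
  have h52 : pdev V < α₀' * ((((ℓ + 1 : ℕ) : ℝ) ^ j)⁻¹) ^ 2 := pdev_retract_block_lt i hG1 U hc hMα hreg hK s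
  have havg := avgIter_mem (ℓ + 1) hL2 hG j V hVu hα' hα3 hα2 h52
  -- the leg reads `U♯` on the block only: replace by the retraction, then every averaged leg is `G`-valued
  have hknit : knitT i (bgT (ℓ + 1) (liftCfg U)) w = compT (ℓ + 1) (bgT (ℓ + 1) V) j s.1.2 w.1 := by
    show compT (ℓ + 1) (bgT (ℓ + 1) (liftCfg U)) (levY i w) (blk ((ℓ + 1) ^ levY i w) w.1) w.1 = _
    rw [hjw, hyw, ← hit]
    exact compT_bgT_congr hL1 j w.1 (by rw [hit]; exact hagree)
  rw [hknit]
  exact compT_mem (ℓ + 1) j (fun j' hj' y x => hol_mem_of (havg j' hj'.le) _ _) _ _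

/-- ★★ **ON (3.35) THE KNIT SITE TRANSPORTER `parKnitY U` IS `G`-VALUED** (every pair of sites: a leg, an inverse leg, or `1`), `G` averaging-closed of contractions — the membership law the
knit certificate's guarded `hparG` asks for at `parA := parKnitY`. [cite: Balaban1985BackgroundPropagators, (3.19) p.393, (3.24)–(3.25) p.394, (3.35) p.396; Balaban1985Averaging, Prop. 2 p.26] -/
theorem parKnitY_mem_of_reg335P (hG : AvgClosed (d + 1) (ℓ + 1) G) (hG1 : ∀ u : (Matrix (Fin N) (Fin N) ℂ)ˣ, u ∈ G → ‖(u : Matrix (Fin N) (Fin N) ℂ)‖ ≤ 1)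
    (U : CfgY (Matrix (Fin N) (Fin N) ℂ) i) {c₀ α₀ : ℝ} (hc : c₀ ≤ 10) (hMα : 0 ≤ (kGeo i).M * α₀)
    (hreg : (bg9KP (Matrix (Fin N) (Fin N) ℂ) G i).Reg335 c₀ α₀ U) {α₀' : ℝ} (hα' : 0 < α₀') (hα3 : C0 (d + 1) * α₀' ≤ 1 / 3)
    (hα2 : 2 * α₀' ≤ c2' (d + 1) (ℓ + 1)) (hK : Kpl i ((kGeo i).M * α₀) * (kGeo i).L ^ 4 < α₀') (z w : SiteY i) :
    parKnitY i U z w ∈ G := by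
  have hk := fun w => knitT_mem_of_reg335P i hG hG1 U hc hMα hreg hα' hα3 hα2 hK w
  show parOfT i (bgT (ℓ + 1) (liftCfg U)) z w ∈ _
  unfold parOfT
  split_ifs
  · exact hk w
  · exact G.inv_mem (hk z)
  · exact G.one_mem

end Legs

/-! ## §2 (edition 2, g40) The same for a group closed at a RADIUS `t` (`AvgClosedAt`) — and `SU(N)` for EVERY `N` under an `N`-dependent smallness of `α₀′` (no `N`-cap)

WHY.  §1 asks `AvgClosed (d+1) L G` (closure at radius `1∕4`), which `SU(N)` has by name only for `N ≤ 25` (`B7AvgClosedSpecialUnitarySharp.avgClosed_specialUnitary_of_le`) and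
NOT for `N ≥ 26` (`B7Prop2SpecialUnitary.not_avgClosed_specialUnitary`) — the programme's LOCATED-RANGE (director-ym №304∕№305; void for Track A at `N = 2`, a LADDER note above it).
`B7Prop2SpecialUnitary` already proves [5] Prop. 2 for groups closed at a radius `t` under the one extra smallness `32(d′+1)(d′+4)L²α₀ ≤ t` (`avgIter_mem_at`) and that `SU(N)` is closed at
every `t ≤ 1∕4` with `N·t < π` (`avgClosedAt_specialUnitary`).  §2 reads §1 through them: the knit legs are `G`-valued for `G` closed at radius `t ≥ 32((d+1)+1)((d+1)+4)(ℓ+1)²α₀′`,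
hence `SU(N)`-valued for EVERY `N` once `32((d+1)+1)((d+1)+4)(ℓ+1)²α₀′ ≤ 1∕4` and `N·(32((d+1)+1)((d+1)+4)(ℓ+1)²α₀′) < π` — two x-free numerics on `α₀′` replacing the displayed
`hN : N ≤ 25` of the knit Sect.-B consumers (dag-n06-c `parMemY_parKnitY` ∕ `hclass_C37KY_knit`, at their next edition, on their word).  Proofs = §1 verbatim with
`avgIter_mem ↦ avgIter_mem_at`.
-/

section LegsAt

open scoped Matrix Matrix.Norms.L2Operator
open B7Prop2SpecialUnitary (AvgClosedAt avgIter_mem_at avgClosedAt_specialUnitary specialUnitaryUnits specialUnitaryUnits_le_unitaryUnits)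

variable {N : ℕ} [Nonempty (Fin N)] (i : KIdx d ℓ hd hL b₀ b₁) {G : Subgroup (Matrix (Fin N) (Fin N) ℂ)ˣ}

/-- ★★ **ON (3.35) THE KNIT TRANSPORTER TO EVERY SITE IS `G`-VALUED FOR `G` CLOSED AT A RADIUS `t ≥ 32((d+1)+1)((d+1)+4)(ℓ+1)²α₀′`** (§1's `knitT_mem_of_reg335P` with [5] Prop. 2's
`avgIter_mem_at` in place of `avgIter_mem`). [cite: Balaban1985BackgroundPropagators, (3.19) p.393, (3.35) p.396; Balaban1985Averaging, Prop. 2 (52)–(54) p.26, p.25, p.20] -/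
theorem knitT_mem_of_reg335P_at {t : ℝ} (hG : AvgClosedAt (d + 1) t (ℓ + 1) G) (hG1 : ∀ u : (Matrix (Fin N) (Fin N) ℂ)ˣ, u ∈ G → ‖(u : Matrix (Fin N) (Fin N) ℂ)‖ ≤ 1)
    (U : CfgY (Matrix (Fin N) (Fin N) ℂ) i) {c₀ α₀ : ℝ} (hc : c₀ ≤ 10) (hMα : 0 ≤ (kGeo i).M * α₀)
    (hreg : (bg9KP (Matrix (Fin N) (Fin N) ℂ) G i).Reg335 c₀ α₀ U) {α₀' : ℝ} (hα' : 0 < α₀') (hα3 : C0 (d + 1) * α₀' ≤ 1 / 3)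
    (hα2 : 2 * α₀' ≤ c2' (d + 1) (ℓ + 1)) (hαt : 32 * (((d + 1 : ℕ) : ℝ) + 1) * ((d + 1 : ℕ) + 4) * (((ℓ + 1 : ℕ) : ℝ)) ^ 2 * α₀' ≤ t)
    (hK : Kpl i ((kGeo i).M * α₀) * (kGeo i).L ^ 4 < α₀') (w : SiteY i) :
    knitT i (bgT (ℓ + 1) (liftCfg U)) w ∈ G := by
  letI : CStarAlgebra (Matrix (Fin N) (Fin N) ℂ) := {}
  have hL1 : 1 ≤ ℓ + 1 := Nat.succ_pos ℓ
  have hL2 : 2 ≤ ℓ + 1 := hL.2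
  set s : BlkY i := blkOf i.D.toDomains w with hs
  set j : ℕ := s.1.1 with hj
  have hjw : levY i w = j := rfl
  have hyw : blk ((ℓ + 1) ^ j) w.1 = s.1.2 := rfl
  have hit : (blockMap (ℓ + 1))^[j] w.1 = s.1.2 := by rw [blockMap_iterate, ← blk_eq_blockMap]; exact hyw
  -- the retraction of `U♯` to the block box of `s`
  set lo : LSite (d + 1) := blockBase ((ℓ + 1) ^ j) s.1.2 with hlo
  set hi : LSite (d + 1) := blockBase ((ℓ + 1) ^ j) s.1.2 + ((((ℓ + 1 : ℕ) : ℤ) ^ j) - 1) • (1 : LSite (d + 1)) with hhi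
  set V : LSite (d + 1) → Fin (d + 1) → (Matrix (Fin N) (Fin N) ℂ)ˣ := retrCfg lo hi (liftCfg U) with hV
  have hagree : AgreeOn lo hi (liftCfg U) V := fun x μ hx hxe => (retrCfg_eq_of_bondIn (liftCfg U) ⟨hx, hxe⟩).symm
  have hU : ∀ μ x, U μ x ∈ G := fun μ x => mem_of_reg335P (G := G) i hreg μ x
  have hVu : ∀ x μ, V x μ ∈ G := fun x μ => retrCfg_mem (fun x μ => liftCfg_mem hU x μ) x μ
  have h52 : pdev V < α₀' * ((((ℓ + 1 : ℕ) : ℝ) ^ j)⁻¹) ^ 2 := pdev_retract_block_lt i hG1 U hc hMα hreg hK s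
  have havg := avgIter_mem_at (ℓ + 1) hL2 hG j V hVu hα' hα3 hα2 (by exact_mod_cast hαt) h52
  -- the leg reads `U♯` on the block only: replace by the retraction, then every averaged leg is `G`-valued
  have hknit : knitT i (bgT (ℓ + 1) (liftCfg U)) w = compT (ℓ + 1) (bgT (ℓ + 1) V) j s.1.2 w.1 := by
    show compT (ℓ + 1) (bgT (ℓ + 1) (liftCfg U)) (levY i w) (blk ((ℓ + 1) ^ levY i w) w.1) w.1 = _
    rw [hjw, hyw, ← hit]
    exact compT_bgT_congr hL1 j w.1 (by rw [hit]; exact hagree)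
  rw [hknit]
  exact compT_mem (ℓ + 1) j (fun j' hj' y x => hol_mem_of (havg j' hj'.le) _ _) _ _

/-- ★★ **ON (3.35) THE KNIT SITE TRANSPORTER `parKnitY U` IS `G`-VALUED FOR `G` CLOSED AT A RADIUS `t ≥ 32((d+1)+1)((d+1)+4)(ℓ+1)²α₀′`** (every pair of sites: a leg, an inverse leg,
or `1`). [cite: Balaban1985BackgroundPropagators, (3.19) p.393, (3.24)–(3.25) p.394, (3.35) p.396; Balaban1985Averaging, Prop. 2 p.26, p.20] -/
theorem parKnitY_mem_of_reg335P_at {t : ℝ} (hG : AvgClosedAt (d + 1) t (ℓ + 1) G) (hG1 : ∀ u : (Matrix (Fin N) (Fin N) ℂ)ˣ, u ∈ G → ‖(u : Matrix (Fin N) (Fin N) ℂ)‖ ≤ 1)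
    (U : CfgY (Matrix (Fin N) (Fin N) ℂ) i) {c₀ α₀ : ℝ} (hc : c₀ ≤ 10) (hMα : 0 ≤ (kGeo i).M * α₀)
    (hreg : (bg9KP (Matrix (Fin N) (Fin N) ℂ) G i).Reg335 c₀ α₀ U) {α₀' : ℝ} (hα' : 0 < α₀') (hα3 : C0 (d + 1) * α₀' ≤ 1 / 3)
    (hα2 : 2 * α₀' ≤ c2' (d + 1) (ℓ + 1)) (hαt : 32 * (((d + 1 : ℕ) : ℝ) + 1) * ((d + 1 : ℕ) + 4) * (((ℓ + 1 : ℕ) : ℝ)) ^ 2 * α₀' ≤ t)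
    (hK : Kpl i ((kGeo i).M * α₀) * (kGeo i).L ^ 4 < α₀') (z w : SiteY i) :
    parKnitY i U z w ∈ G := by
  have hk := fun w => knitT_mem_of_reg335P_at i hG hG1 U hc hMα hreg hα' hα3 hα2 hαt hK w
  show parOfT i (bgT (ℓ + 1) (liftCfg U)) z w ∈ _
  unfold parOfT
  split_ifs
  · exact hk w
  · exact G.inv_mem (hk z)
  · exact G.one_mem

/-- ★★★ **ON (3.35) THE KNIT SITE TRANSPORTER IS `SU(N)`-VALUED FOR EVERY `N`** under the two x-free numerics `32((d+1)+1)((d+1)+4)(ℓ+1)²α₀′ ≤ 1∕4` and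
`N·(32((d+1)+1)((d+1)+4)(ℓ+1)²α₀′) < π` (closure of `SU(N)` at the radius the averaged legs stay within, `avgClosedAt_specialUnitary`): the `N`-free replacement of the knit
Sect.-B consumers' `hN : N ≤ 25` (`avgClosed_specialUnitary_of_le`). [cite: Balaban1985BackgroundPropagators, (3.19) p.393, (3.35) p.396, pp.389–390 (G ⊂ U(N)); Balaban1985Averaging, Prop. 2 p.26, (22)–(23) p.21, p.20] -/
theorem parKnitY_mem_SU_of_reg335P (U : CfgY (Matrix (Fin N) (Fin N) ℂ) i) {c₀ α₀ : ℝ} (hc : c₀ ≤ 10) (hMα : 0 ≤ (kGeo i).M * α₀)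
    (hreg : (bg9KP (Matrix (Fin N) (Fin N) ℂ) (specialUnitaryUnits (Fin N)) i).Reg335 c₀ α₀ U) {α₀' : ℝ} (hα' : 0 < α₀') (hα3 : C0 (d + 1) * α₀' ≤ 1 / 3)
    (hα2 : 2 * α₀' ≤ c2' (d + 1) (ℓ + 1)) (hα4N : 32 * (((d + 1 : ℕ) : ℝ) + 1) * ((d + 1 : ℕ) + 4) * (((ℓ + 1 : ℕ) : ℝ)) ^ 2 * α₀' ≤ 1 / 4)
    (hαπN : (N : ℝ) * (32 * (((d + 1 : ℕ) : ℝ) + 1) * ((d + 1 : ℕ) + 4) * (((ℓ + 1 : ℕ) : ℝ)) ^ 2 * α₀') < Real.pi)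
    (hK : Kpl i ((kGeo i).M * α₀) * (kGeo i).L ^ 4 < α₀') (z w : SiteY i) :
    parKnitY i U z w ∈ specialUnitaryUnits (Fin N) :=
  parKnitY_mem_of_reg335P_at i (avgClosedAt_specialUnitary (d + 1) (ℓ + 1) hα4N (by simpa only [Fintype.card_fin] using hαπN))
    (fun u hu => (CStarRing.norm_of_mem_unitary (B7Prop2Explicit.mem_unitaryUnits.1 (specialUnitaryUnits_le_unitaryUnits hu))).le)
    U hc hMα hreg hα' hα3 hα2 le_rfl hK z w

end LegsAt

end Literature.MathematicalPhysics.QuantumFieldTheory.Balaban1983to89.B9Eq3124HZKnitPairReg335YMemG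

end
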